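import Summits.AnomalousDissipation.AnomalousDissipation.Theses.MarginalStabilityChain
import Summits.AnomalousDissipation.AnomalousDissipation.Cruxes.BurgersLayerKH.SketchIdeator2
import Literature.Analysis.ODE.ComplexSecondOrder
import Literature.Analysis.ODE.WronskianMatching

/-!
# Line `vortex-sheet-unfolding` for the crux `MarginalStabilityChain.BurgersLayerKH`
(item stmt-AnomalousDissipation-3008) — CHECKED SKELETON (crux-plan, round 1, 2026-08-16)

Idea (card `Cruxes/BurgersLayerKH/Ideas/vortex-sheet-unfolding.md`, triage r1: 2 × pass, merged with
`vortex-sheet-continuation`). The KH mode of the Burgers layer is the Kelvin–Helmholtz mode of the VORTEX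
SHEET with the same jump, dressed by the Gaussian layer. On the ODE side: for the Rayleigh equation of the
erf profile `U(y) = ∫₀ʸ e^{−s²/2} ds`, written `φ'' = (α² + U''/(U − c)) φ`, ZERO ENERGY IS A RESONANCE
FOR EVERY `c` (`ψ₁ = U − c` solves it at `α = 0`), so the Wronskian `W(α, c)` of the two normalised Jost
solutions `f₊ ~ e^{−αy}` (`y → +∞`), `f₋ ~ e^{αy}` (`y → −∞`) vanishes identically at `α = 0`, and
`W(α, c)/α → F(0, c) := (U₊−c)/(U₋−c) + (U₋−c)/(U₊−c)` (`U± = ±√(π/2)`), the KH dispersion function of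
the sheet, whose root `c₀ = i√(π/2)` is simple. Following BOTH triagers' sharpening the root is continued
along the imaginary axis `c = is` only, where (oddness of `U` ⇒ `f₋ = J f₊`, `J φ = conj φ(−·)`) the
reduced Evans function is REAL, `F(0, is) = 2(s² − π/2)/(s² + π/2)` changes sign at `s = √(π/2)`, and the
intermediate value theorem replaces the holomorphic implicit-function step (no Hurwitz, no holomorphy in
`c` is needed anywhere). A zero `W(α, is) = 0`, `α > 0`, is a decaying Rayleigh eigenfunction
(`IsRayleighMode α (is) φ`, `Im c = s ≈ √(π/2) > 0`), and the persistence lever shared by all lines of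
this crux (`PersistenceQuant`, cards gaussian-splitting-persistence ≈ dissipative-compact-persistence:
skew + compact + (1/Re)·dissipative Ornstein–Uhlenbeck in `L²(e^{y²/2})`) turns it into the crux with
`c₀(crux) = α·s/2` and `Re₂ = Re₂(α, s)`.

Audit target: `BurgersLayerKH_of : Sig.stub_sheetUnfolding → Sig.stub_modeOfEvansZero →
Sig.stub_persistence → BurgersLayerKH` (the route decl, BY NAME; hypothesis heads = stub names);
`sorry` only in the three registered `theorem stub_* : Sig.stub_*`; `BurgersLayerKH_proof` is the
skeleton in its final shape.

Stubs (3): `stub_sheetUnfolding` (the card's Transfer C⁺ on the axis: Jost family for `α ∈ (0, α₀]`,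
`s` near `√(π/2)`, jointly continuous reduced Evans function down to `α = 0` with the SHEET LIMIT
`F(0, is)` there, real on the axis; size M–L, the line-specific load-bearing lemma — the zero-energy
Volterra equation `m = 1 + ∫_y^∞ k_α(s−y) V m`, `0 ≤ k_α(r) = (1 − e^{−2αr})/(2α) ≤ r`, with two Gaussian
moments of `V = U''/(U − is)`, uniformly in `α ∈ [0, α₀]`); `stub_modeOfEvansZero` (a Wronskian zero of a
normalised Jost pair at `α > 0`, `Im c > 0` is a Rayleigh mode; size S–M, shared verbatim with the
B-lines odd-evans-ivt / pt-standing-mode-continuation); `stub_persistence` (= `PersistenceQuant` of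
`SketchIdeator2.lean`, the A-lever; size L, HARDEST in Lean cost — Mathlib-thin operator theory —
and shared with every other line of the crux, so it is imported BY NAME, not re-cut here).

Disproof honoured (`Cruxes/BurgersLayerKH/Disproof.lean`, cdisprove v4b, read 2026-08-16):
`burgersLayerKH_false_without_coupling` — the coupling `U''ψ` is used twice: it IS the Rayleigh
potential `U''/(U − c)` of `rayleighCoeff` (stub_sheetUnfolding, stub_modeOfEvansZero) and the compact
part whose eigenvalue persists (stub_persistence); `burgersLayerKH_false_forall_Re` — the threshold is
`Re₂(α, s)` delivered by stub_persistence (`0 < Re₂`); tightness `not_burgersLayerKHWithRate_of_gt`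
(`c ≤ √(π/2)`) — here `c₀(crux) = αs/2 ≤ α₀(√(π/2) + η)/2 ≪ √(π/2)`; `burgersLayerKH_false_real_mode` —
the Jost solutions of the complex potential `U''/(U − is)` are genuinely complex (`f₋ = conj f₊(−·)`),
`σ` is expected real (standing) but `ψ` is not. `trivial_without_nonzero`: non-triviality comes from
`e^{αy} f₊ → 1`. No landed `Theorems/…/Negative/` lemma exists for this crux (checked 2026-08-16);
`ledger negatives` (5 items) unrelated.
-/

set_option linter.dupNamespace false

noncomputable section

namespace Summit.AnomalousDissipation.AnomalousDissipation.Cruxes.BurgersLayerKH.VortexSheetUnfolding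

open Filter Topology Set Metric
open Summit.AnomalousDissipation.AnomalousDissipation.Theses.MarginalStabilityChain (BurgersLayerKH)
open Summit.AnomalousDissipation.AnomalousDissipation.Cruxes.BurgersLayerKH
  (erfU erfU'' IsRayleighMode IsStrainedMode PersistenceQuant evansAtZeroAlpha)
open Literature.Analysis.ODE (IsSol2 wronskian)

/-! ### Objects of the line -/

/-- The Rayleigh coefficient of the erf layer, `q_{α,c}(y) = α² + U''(y)/(U(y) − c)`
(`φ'' = q φ` ⇔ `(U − c)(φ'' − α²φ) − U''φ = 0` when `U − c ≠ 0`, e.g. `Im c ≠ 0`). -/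
def rayleighCoeff (α : ℝ) (c : ℂ) (y : ℝ) : ℂ :=
  (α : ℂ) ^ 2 + (erfU'' y : ℂ) / ((erfU y : ℂ) - c)

/-- A NORMALISED JOST PAIR at `(α, c)`: global classical solutions `fp`, `fm` (with derivatives `fp'`,
`fm'`) of `φ'' = q_{α,c} φ` on `ℝ`, `fp` recessive at `+∞` with `e^{αy} fp → 1`, `e^{αy} fp' → −α`, and
`fm` recessive at `−∞` with `e^{−αy} fm → 1`, `e^{−αy} fm' → α`. (At `α = 0` these would be
`(U − c)/(U± − c)`; the pair is only used for `α > 0`.) -/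
def IsJostPair (α : ℝ) (c : ℂ) (fp fp' fm fm' : ℝ → ℂ) : Prop :=
  IsSol2 (rayleighCoeff α c) fp fp' Set.univ ∧ IsSol2 (rayleighCoeff α c) fm fm' Set.univ ∧
    Tendsto (fun y : ℝ => Complex.exp ((α : ℂ) * y) * fp y) atTop (𝓝 1) ∧
    Tendsto (fun y : ℝ => Complex.exp ((α : ℂ) * y) * fp' y) atTop (𝓝 (-(α : ℂ))) ∧
    Tendsto (fun y : ℝ => Complex.exp (-((α : ℂ) * y)) * fm y) atBot (𝓝 1) ∧
    Tendsto (fun y : ℝ => Complex.exp (-((α : ℂ) * y)) * fm' y) atBot (𝓝 (α : ℂ))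

/-- THE SHEET LIMIT on the imaginary axis: `F(0, is) = 2(s² − π/2)/(s² + π/2)`, the value at `c = is`
of the vortex-sheet dispersion function `F(0,c) = ((U₊−c)² + (U₋−c)²)/((U₊−c)(U₋−c))`
(`evansAtZeroAlpha`; see `sheetLimit_eq_evansAtZeroAlpha`). Negative for `0 ≤ s < √(π/2)`, positive
for `s > √(π/2)`: the Helmholtz eigenvalue `i√(π/2) = iΔU/2` of the sheet of strength `ΔU = √(2π)`. -/
def sheetLimit (s : ℝ) : ℝ :=
  2 * (s ^ 2 - Real.pi / 2) / (s ^ 2 + Real.pi / 2)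

/-- THE REDUCED EVANS FUNCTION ON THE AXIS of a Jost family `(α, s) ↦ (fp α s, …)`:
`E(s, α) = W(α, is)/α` for `α ≠ 0`, where `W = fp(0)·fm'(0) − fp'(0)·fm(0)`
(`Literature.Analysis.ODE.wronskian`, this orientation), and the sheet limit `F(0, is)` at `α = 0`. -/
def evansAxis (fp fp' fm fm' : ℝ → ℝ → ℝ → ℂ) (s α : ℝ) : ℂ :=
  if α = 0 then (sheetLimit s : ℂ)
  else wronskian (fp α s) (fp' α s) (fm α s) (fm' α s) 0 / (α : ℂ)

/-! ### The three registered stubs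

Each stub's statement is the `Prop` `Sig.stub_<name>` (its SIGNATURE); the registered obligation is
`theorem stub_<name> : Sig.stub_<name> := by sorry`; `BurgersLayerKH_of` takes the three signatures as
hypotheses BY NAME. -/

/-- STUB 1 — VORTEX-SHEET UNFOLDING ON THE AXIS (the card's Transfer C⁺; size M–L; the line-specific
load-bearing lemma). There are `α₀ > 0`, a window `η ∈ (0, √(π/2))` and a Jost FAMILY
`(α, s) ↦ (fp, fp', fm, fm')` such that
(i) for `0 < α ≤ α₀` and `|s − √(π/2)| ≤ η` it is a normalised Jost pair for `c = is`
(`inf_y |U(y) − is| = s ≥ √(π/2) − η > 0`: no critical layer; the potential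
`V = U''/(U − is) = −y e^{−y²/2}/(U − is)` has Gaussian tails, so `fp = e^{−αy} m`,
`m(y) = 1 + ∫_y^∞ k_α(t − y) V(t) m(t) dt`, `k_α(r) = (1 − e^{−2αr})/(2α) ∈ [0, r]`, converges by Volterra
iteration on every `[a, ∞)` uniformly in `α ∈ [0, α₀]`, and one may take `fm := conj ∘ fp ∘ (−·)`
since `V(−y) = conj V(y)` for odd `U`);
(ii) the reduced Evans function `E(s, α) = W(α, is)/α` extends CONTINUOUSLY (jointly) to the closed
rectangle `[√(π/2) − η, √(π/2) + η] × [0, α₀]` with the value `F(0, is) = 2(s² − π/2)/(s² + π/2)` at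
`α = 0` — the sheet limit: `W(0, ·) ≡ 0` because `fp⁰ = (U − is)/(U₊ − is)` and
`fm⁰ = (U − is)/(U₋ − is)` are proportional, and `∂_α W(0, is) = W[g₊, fm⁰] + W[fp⁰, g₋]` with
`g₊ = ∂_α fp|₀ = −(U₊ − c)ψ₂ + a₊ψ₁`, `g₋ = (U₋ − c)ψ₂ + a₋ψ₁` (`ψ₁ = U − c`, `ψ₂ = ψ₁∫ψ₁⁻²`,
`W[ψ₁, ψ₂] = 1`; `∂_α k_α|₀(r) = −r²`) equals `(U₊−c)/(U₋−c) + (U₋−c)/(U₊−c)`; orientation and sign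
confirmed numerically (planner, `num/evans_orientation.py`: `W/α = −0.434, +0.362` at `α = 0.002`,
`c = i, 1.5i` vs `F = −0.444, +0.356`; triage r1-1/r1-2 shooting agrees to `O(α)`);
(iii) `E(s, α)` is REAL on the rectangle (`fm = J fp` ⇒ `W = −2 re(fp(0)·conj fp'(0))`).
Why plausibly true: classical low-energy Jost/Evans expansion at a zero-energy resonance, here with
all moments of `V` finite (Gaussian) and no critical layer; every prediction checked by four independent
codes (j004866, j005352, triage r1-1, r1-2: `c_i(α) = 1.2022, 1.1288, 1.0144` at `α = 0.02, 0.05, 0.1`,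
i.e. `√(π/2) − c_i ≈ 2.5α`). In tree: `IsSol2`, `wronskian`, `hasDerivAt_wronskian₂`,
`wronskian_eq_neg_integral_Ioi`, `exists_volterra_recessiveSolution` (pattern), `jostY`/`contDiffAt_jostY_param`
(NOT applicable uniformly as `α → 0`: `jostKconst ~ 1/α`), `hasDerivAt_burgersLayerProfile`,
`integral_gaussian`. -/
def Sig.stub_sheetUnfolding : Prop :=
  ∃ α₀ : ℝ, 0 < α₀ ∧ ∃ η : ℝ, 0 < η ∧ η < Real.sqrt (Real.pi / 2) ∧
    ∃ fp fp' fm fm' : ℝ → ℝ → ℝ → ℂ,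
      (∀ α : ℝ, 0 < α → α ≤ α₀ →
        ∀ s ∈ Set.Icc (Real.sqrt (Real.pi / 2) - η) (Real.sqrt (Real.pi / 2) + η),
          IsJostPair α ((s : ℂ) * Complex.I) (fp α s) (fp' α s) (fm α s) (fm' α s)) ∧
      ContinuousOn (fun q : ℝ × ℝ => evansAxis fp fp' fm fm' q.1 q.2)
        (Set.Icc (Real.sqrt (Real.pi / 2) - η) (Real.sqrt (Real.pi / 2) + η) ×ˢ Set.Icc 0 α₀) ∧
      (∀ s ∈ Set.Icc (Real.sqrt (Real.pi / 2) - η) (Real.sqrt (Real.pi / 2) + η),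
        ∀ α ∈ Set.Icc (0 : ℝ) α₀, (evansAxis fp fp' fm fm' s α).im = 0)

/-- STUB 2 — A WRONSKIAN ZERO OF A JOST PAIR IS A RAYLEIGH MODE (size S–M; shared with the B-lines).
For `α > 0`, `Im c > 0` and a normalised Jost pair whose Wronskian vanishes at `0` (hence everywhere), the
recessive solution `fp` is a classical unstable Rayleigh mode of the erf layer:
`W ≡ 0` and `(fp(0), fp'(0)) ≠ 0` (else `fp ≡ 0`, contradicting `e^{αy}fp → 1`) give `fm = κ·fp` on
`ℝ` with `κ ≠ 0` (`IsSol2.eqOn`/uniqueness, cf. `IsSol2.exists_eq_smul_of_wronskian_eq_zero`), so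
`fp = O(e^{−α|y|})` at both ends; `fp ∈ C²` and `(U − c)(fp'' − α²fp) − U''fp = 0` pointwise from
`IsSol2 (rayleighCoeff α c)` (`U − c ≠ 0` as `Im c > 0`, `U` real); `fp ≢ 0`. -/
def Sig.stub_modeOfEvansZero : Prop :=
  ∀ α : ℝ, 0 < α → ∀ c : ℂ, 0 < c.im → ∀ fp fp' fm fm' : ℝ → ℂ,
    IsJostPair α c fp fp' fm fm' → wronskian fp fp' fm fm' 0 = 0 →
      ∃ φ : ℝ → ℂ, IsRayleighMode α c φ

/-- STUB 3 — PERSISTENCE UNDER STRAIN + VISCOSITY AT FIXED WAVENUMBER (the A-lever, = `PersistenceQuant`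
of `Cruxes/BurgersLayerKH/SketchIdeator2.lean`, shared BY NAME with the lines of the cards
gaussian-splitting-persistence ≈ dissipative-compact-persistence ≈ gaussian-dissipative-birman-schwinger;
size L, the hardest stub in Lean cost). For every Rayleigh mode `(α, c, φ)` and `ρ > 0` there is `Re₂ > 0`
such that for `Re ≥ Re₂` the strained viscous operator AT THE SAME `α` has an eigenpair `(σ, ψ)` in the
crux's class (`IsStrainedMode Re α σ ψ` = the body of `BurgersLayerKH` minus the growth clause) with
`‖σ/Re + iαc‖ < ρ`. Mechanism (triage-verified step by step): in vorticity form on `X = L²(e^{y²/2})`,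
`σ/Re` is an eigenvalue of `M + K + εA`, `ε = 1/Re`, `M = −iαU·` skew, `Kω = −iαU''·(G_α∗ω)`
Hilbert–Schmidt, `A = ∂² + y∂ + 1 − α² ≤ −α²` self-adjoint (OU/Hermite): `‖(M + εA − z)⁻¹‖ ≤ 1/re z`
uniformly in `ε ≥ 0` (= Disproof §2 `re_le_of_noCoupling` read as an inequality), strong → norm
convergence of `(M + εA − z)⁻¹K` by compactness, and persistence of the isolated eigenvalue
`λ₀ = −iαc` (`re λ₀ = α·Im c > 0`) of `M + K` by a finite-rank/regularised-determinant reduction +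
`Complex.eventually_exists_zero_mem_ball_of_tendstoUniformlyOn` (or IVT on the `J`-real determinant for
standing modes); `ω ∈ D(A)` gives `|ω| ≤ Ce^{−y²/4}` and the ODE bootstraps `ψ = G_α∗ω ∈ C⁴`, `ψ → 0`.
Numerics: `σ(Re, α) = s₀(α)Re + s₁(α) + O(1/Re)`, `s₁ ≈ −0.45` (j004789, j004866, j004783). -/
def Sig.stub_persistence : Prop :=
  PersistenceQuant

/-- Registered stub 1 (vortex-sheet unfolding on the axis — Transfer C⁺, load-bearing for this line). -/
theorem stub_sheetUnfolding : Sig.stub_sheetUnfolding := by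
  sorry

/-- Registered stub 2 (Wronskian zero of a Jost pair ⇒ Rayleigh mode). -/
theorem stub_modeOfEvansZero : Sig.stub_modeOfEvansZero := by
  sorry

/-- Registered stub 3 (persistence at fixed wavenumber — the shared A-lever, hardest). -/
theorem stub_persistence : Sig.stub_persistence := by
  sorry

/-! ### Elementary facts used by the composition -/

/-- The sheet limit is negative below the sheet value `√(π/2)`. -/
theorem sheetLimit_neg {s : ℝ} (hs0 : 0 ≤ s) (hs : s < Real.sqrt (Real.pi / 2)) : sheetLimit s < 0 := by
  unfold sheetLimit
  have hpi : 0 < Real.pi / 2 := by positivity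
  have hsq : s ^ 2 < Real.pi / 2 := by
    have h1 : s ^ 2 < Real.sqrt (Real.pi / 2) ^ 2 := by
      exact pow_lt_pow_left₀ hs hs0 (by norm_num)
    rwa [Real.sq_sqrt hpi.le] at h1
  have hden : 0 < s ^ 2 + Real.pi / 2 := by positivity
  apply div_neg_of_neg_of_pos _ hden
  linarith

/-- The sheet limit is positive above the sheet value `√(π/2)`. -/
theorem sheetLimit_pos {s : ℝ} (hs : Real.sqrt (Real.pi / 2) < s) : 0 < sheetLimit s := by
  unfold sheetLimit
  have hpi : 0 < Real.pi / 2 := by positivity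
  have hs0 : 0 ≤ s := (Real.sqrt_nonneg _).trans hs.le
  have hsq : Real.pi / 2 < s ^ 2 := by
    have h1 : Real.sqrt (Real.pi / 2) ^ 2 < s ^ 2 := by
      exact pow_lt_pow_left₀ hs (Real.sqrt_nonneg _) (by norm_num)
    rwa [Real.sq_sqrt hpi.le] at h1
  have hden : 0 < s ^ 2 + Real.pi / 2 := by positivity
  apply div_pos _ hden
  linarith

/-- Sanity (an `example`, not used by the composition): the closed form on the axis IS the vortex-sheet
dispersion function `evansAtZeroAlpha` of `SketchIdeator2` evaluated at `c = is`. -/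
example (s : ℝ) : (sheetLimit s : ℂ) = evansAtZeroAlpha ((s : ℂ) * Complex.I) := by
  have hpi : 0 < Real.pi / 2 := by positivity
  have ha2 : ((Real.sqrt (Real.pi / 2) : ℝ) : ℂ) ^ 2 = (Real.pi : ℂ) / 2 := by
    rw [← Complex.ofReal_pow, Real.sq_sqrt hpi.le]; push_cast; ring
  have hI : Complex.I ^ 2 = -1 := Complex.I_sq
  have hden : ((Real.sqrt (Real.pi / 2) : ℝ) - (s : ℂ) * Complex.I) *
      (-((Real.sqrt (Real.pi / 2) : ℝ) : ℂ) - (s : ℂ) * Complex.I) = -((s : ℂ) ^ 2 + (Real.pi : ℂ) / 2) := by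
    linear_combination ((s : ℂ) ^ 2) * hI - ha2
  have hnum : (((Real.sqrt (Real.pi / 2) : ℝ) : ℂ) - (s : ℂ) * Complex.I) ^ 2 +
      (-((Real.sqrt (Real.pi / 2) : ℝ) : ℂ) - (s : ℂ) * Complex.I) ^ 2 =
        -(2 * ((s : ℂ) ^ 2 - (Real.pi : ℂ) / 2)) := by
    linear_combination (2 * (s : ℂ) ^ 2) * hI + 2 * ha2
  unfold sheetLimit evansAtZeroAlpha
  simp only
  rw [hnum, hden, neg_div_neg_eq]
  push_cast
  ring

/-! ### The composition: the three stubs give the crux BY NAME -/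

/-- The line: vortex-sheet unfolding on the axis + (Wronskian zero ⇒ mode) + persistence imply
`MarginalStabilityChain.BurgersLayerKH`. Choice of constants: `α = min(α₀, δ)` small enough that the
endpoint signs of `F(0, is)` at `s = √(π/2) ∓ η` survive (joint continuity at `α = 0`); `s = s(α)` a zero
of the real function `re E(·, α)` (IVT); `c = is`, `c₀(crux) = α s/2`, `Re₂` from persistence with
tolerance `ρ = α s/2`. -/
theorem BurgersLayerKH_of :
    Sig.stub_sheetUnfolding → Sig.stub_modeOfEvansZero → Sig.stub_persistence → BurgersLayerKH := by
  intro h₁ h₂ h₃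
  obtain ⟨α₀, hα₀, η, hη, hηu, fp, fp', fm, fm', hJ, hcont, hreal⟩ := h₁
  set u : ℝ := Real.sqrt (Real.pi / 2) with hu
  have hupos : 0 < u := Real.sqrt_pos.2 (by positivity)
  set E : ℝ → ℝ → ℂ := evansAxis fp fp' fm fm' with hE
  -- the sheet limit changes sign across `s = u`
  have hE0 : ∀ s, E s 0 = (sheetLimit s : ℂ) := fun s => by simp [hE, evansAxis]
  have hlo0 : (E (u - η) 0).re < 0 := by
    rw [hE0, Complex.ofReal_re]
    exact sheetLimit_neg (by linarith) (by linarith)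
  have hhi0 : 0 < (E (u + η) 0).re := by
    rw [hE0, Complex.ofReal_re]
    exact sheetLimit_pos (by linarith)
  -- membership facts
  have hlo_mem : u - η ∈ Set.Icc (u - η) (u + η) := ⟨le_rfl, by linarith⟩
  have hhi_mem : u + η ∈ Set.Icc (u - η) (u + η) := ⟨by linarith, le_rfl⟩
  have h0_mem : (0 : ℝ) ∈ Set.Icc (0 : ℝ) α₀ := ⟨le_rfl, hα₀.le⟩
  -- joint continuity at `α = 0` keeps the endpoint signs for small `α > 0`
  have hkeep : ∀ s₀ ∈ Set.Icc (u - η) (u + η), ∀ ε > 0, ∃ δ > 0, ∀ α : ℝ, 0 < α → α < δ → α ≤ α₀ →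
      |(E s₀ α).re - (E s₀ 0).re| < ε := by
    intro s₀ hs₀ ε hε
    have hcw : ContinuousWithinAt (fun q : ℝ × ℝ => E q.1 q.2)
        (Set.Icc (u - η) (u + η) ×ˢ Set.Icc 0 α₀) (s₀, 0) := hcont (s₀, 0) ⟨hs₀, h0_mem⟩
    obtain ⟨δ, hδ, hδ'⟩ := Metric.continuousWithinAt_iff.1 hcw ε hε
    refine ⟨δ, hδ, fun α hαp hαδ hαle => ?_⟩
    have hmem : ((s₀, α) : ℝ × ℝ) ∈ Set.Icc (u - η) (u + η) ×ˢ Set.Icc 0 α₀ :=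
      ⟨hs₀, ⟨hαp.le, hαle⟩⟩
    have hdist : dist ((s₀, α) : ℝ × ℝ) (s₀, 0) < δ := by
      rw [Prod.dist_eq, dist_self, Real.dist_eq, sub_zero, abs_of_pos hαp, max_eq_right hαp.le]
      exact hαδ
    have h := hδ' hmem hdist
    rw [Complex.dist_eq] at h
    calc |(E s₀ α).re - (E s₀ 0).re| = |(E s₀ α - E s₀ 0).re| := by rw [Complex.sub_re]
      _ ≤ ‖E s₀ α - E s₀ 0‖ := Complex.abs_re_le_norm _
      _ < ε := h
  obtain ⟨δ₁, hδ₁, hδ₁'⟩ := hkeep (u - η) hlo_mem (-(E (u - η) 0).re / 2) (by linarith)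
  obtain ⟨δ₂, hδ₂, hδ₂'⟩ := hkeep (u + η) hhi_mem ((E (u + η) 0).re / 2) (by linarith)
  -- the wavenumber
  set α : ℝ := min (min (δ₁ / 2) (δ₂ / 2)) α₀ with hαdef
  have hαpos : 0 < α := lt_min (lt_min (by linarith) (by linarith)) hα₀
  have hαle : α ≤ α₀ := min_le_right _ _
  have hαδ₁ : α < δ₁ := by
    have : α ≤ δ₁ / 2 := (min_le_left _ _).trans (min_le_left _ _)
    linarith
  have hαδ₂ : α < δ₂ := by
    have : α ≤ δ₂ / 2 := (min_le_left _ _).trans (min_le_right _ _)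
    linarith
  have hlo : (E (u - η) α).re < 0 := by
    have h := hδ₁' α hαpos hαδ₁ hαle
    have h' := (abs_lt.1 h).2
    linarith
  have hhi : 0 < (E (u + η) α).re := by
    have h := hδ₂' α hαpos hαδ₂ hαle
    have h' := (abs_lt.1 h).1
    linarith
  -- IVT in `s` for the real function `re E(·, α)`
  have hg : ContinuousOn (fun s : ℝ => (E s α).re) (Set.Icc (u - η) (u + η)) := by
    have h1 : ContinuousOn (fun s : ℝ => ((s, α) : ℝ × ℝ)) (Set.Icc (u - η) (u + η)) :=
      (continuous_id.prodMk continuous_const).continuousOn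
    have h2 : Set.MapsTo (fun s : ℝ => ((s, α) : ℝ × ℝ)) (Set.Icc (u - η) (u + η))
        (Set.Icc (u - η) (u + η) ×ˢ Set.Icc 0 α₀) := fun s hs => ⟨hs, ⟨hαpos.le, hαle⟩⟩
    exact Complex.continuous_re.comp_continuousOn (hcont.comp h1 h2)
  obtain ⟨s, hs, hs0⟩ : ∃ s ∈ Set.Icc (u - η) (u + η), (E s α).re = 0 := by
    have h := intermediate_value_Icc (show u - η ≤ u + η by linarith) hg
    exact h ⟨hlo.le, hhi.le⟩
  have hspos : 0 < s := by linarith [hs.1]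
  -- the reduced Evans function vanishes at `(s, α)`, hence so does the Wronskian (`α ≠ 0`)
  have hEz : E s α = 0 := Complex.ext hs0 (by simpa using hreal s hs α ⟨hαpos.le, hαle⟩)
  have hW : wronskian (fp α s) (fp' α s) (fm α s) (fm' α s) 0 = 0 := by
    have hne : α ≠ 0 := hαpos.ne'
    have hEq : E s α = wronskian (fp α s) (fp' α s) (fm α s) (fm' α s) 0 / (α : ℂ) := by
      simp [hE, evansAxis, hne]
    rw [hEq] at hEz
    rcases div_eq_zero_iff.1 hEz with h | h
    · exact h
    · exact absurd (by exact_mod_cast h : α = 0) hne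
  -- the Rayleigh mode at `c = is`
  set c : ℂ := (s : ℂ) * Complex.I with hc
  have hcim : c.im = s := by simp [hc]
  have hcim_pos : 0 < c.im := by rw [hcim]; exact hspos
  obtain ⟨φ, hφ⟩ := h₂ α hαpos c hcim_pos (fp α s) (fp' α s) (fm α s) (fm' α s)
    (hJ α hαpos hαle s hs) hW
  -- persistence at the same wavenumber, tolerance `ρ = α·Im c/2`
  have hρ : 0 < α * c.im / 2 := by positivity
  obtain ⟨Re₂, hRe₂, hP⟩ := h₃ α c φ hφ (α * c.im / 2) hρ
  refine ⟨Re₂, α * c.im / 2, hρ, fun Re hRe => ?_⟩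
  obtain ⟨σ, ψ, hS, hnorm⟩ := hP Re hRe
  have hRepos : 0 < Re := lt_of_lt_of_le hRe₂ hRe
  -- growth: `re σ ≥ (α·Im c/2)·Re`
  have hgrowth : α * c.im / 2 * Re ≤ σ.re := by
    have h1 : |(σ / (Re : ℂ) + Complex.I * (α : ℂ) * c).re| < α * c.im / 2 :=
      (Complex.abs_re_le_norm _).trans_lt hnorm
    have h2 : (σ / (Re : ℂ) + Complex.I * (α : ℂ) * c).re = σ.re / Re - α * c.im := by
      simp [Complex.add_re, Complex.div_ofReal_re, Complex.mul_re, Complex.mul_im, Complex.I_re,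
        Complex.I_im, Complex.ofReal_re, Complex.ofReal_im]
      ring
    rw [h2] at h1
    have h3 := (abs_lt.1 h1).1
    have h4 : α * c.im / 2 < σ.re / Re := by linarith
    have h5 := (lt_div_iff₀ hRepos).1 h4
    linarith
  obtain ⟨hα', hψ4, hne, htop, hbot, hC, heq⟩ := hS
  exact ⟨α, σ, ψ, hα', hgrowth, hψ4, hne, htop, hbot, hC, heq⟩

/-- The skeleton in its final shape (D-0027 §3.3): the crux BY NAME from the three registered stubs; it
becomes the crux proof when the last `stub_*` is discharged (until then it depends on `sorryAx` through
the stubs only — no `sorry` of its own). -/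
theorem BurgersLayerKH_proof : BurgersLayerKH :=
  BurgersLayerKH_of stub_sheetUnfolding stub_modeOfEvansZero stub_persistence

end Summit.AnomalousDissipation.AnomalousDissipation.Cruxes.BurgersLayerKH.VortexSheetUnfolding

end
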